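import Literature.AlgebraicGeometry.Motives.IntegralModelRestrictScalarsSheets
import Literature.AlgebraicGeometry.Motives.GaloisThickeningFrobeniusSheetwise   -- ★ A-p01 (g23) p845200: the sheet-wise shadow UNDER `hdisj`
import HarnessLib

/-!
# Disjoint special sheets for all but finitely many primes, in the thickening currency of the moduli heart

Topic `Literature/AlgebraicGeometry/Motives`; namespace `Literature.AlgebraicGeometry.Motives.IntegralModel`.  THEOREMS ONLY (+ 1 private);
sequel of ★ `IntegralModelRestrictScalarsSheets` (organ «INT-RES-SHEETS», A-p03 (g28); LEAD F0P6-plan M-12c (a), F0P6c-plan «= (β)», F0P6-ref1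
n25 (J6)).  Two things: (1) **for all but finitely many primes `w` of `F` the localised sheet model `𝓑 ⊗ 𝒪_{F,(w)}` of an intermediate ring
`𝓞 L ⊆ B ⊆ L` (finitely presented over `𝓞 L`, e.g. `𝓞 L[1∕N]`) is ÉTALE and PROPER over `𝒪_{F,(w)}`** — by ★ SP-F
`eventually_isSmoothProper_localise` at `n = 0`, spreading out from the generic fibre `Spec L → Spec F`, which is étale (finite separable; Mathlib
`Algebra.FormallyEtale.of_isSeparable`) and proper (finite); NO ramification theory is typed (the finitely many exceptional `w` contain the primes
ramified in `L`, as they must, since at a ramified prime two sheets in one inertia orbit have the same special image); (2) **the hypothesis `hdisj` of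
the sheet-wise Frobenius shadow (FROB-SHEET ED. 3) in MH's binders**: for a model `𝓜` over `B` of `X ⊗_F L` — so that
`𝓨 := (restrictScalarsOfIntermediate hinj 𝓜).localise w` is a model over `𝒪_{F,(w)}` of the Galois thickening `R_L X` ON THE NOSE — proper, an action
`θ` of `(L ≃ₐ[F] L) × G` on `𝓨` whose `Γ`-part has generic fibre ★ `thickeningGalAction` (MH's `_hθ`), and `w` with `𝓑 ⊗ 𝒪_{F,(w)}`
étale-proper: `red_𝓨 (ℓ_e P) = θ(β,1)_s (red_𝓨 (ℓ_e Q)) → β = 1` (★ `geomReductionMap_map_thickeningGalAction_of_hθ` turns the right side into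
`red_𝓨 (ℓ_{e∘β⁻¹} Q)`, ★ `genericSheet_eq_of_geomReductionMap_eq` gives equal sheets, ★ `embOfPoint_thickeningLift` reads them as `e = e ∘ β⁻¹`).
HC_CM is proved only modulo the printed citations until rung 0 closes; nothing here is about HC.

## References
* [EGAIV4] A. Grothendieck, J. Dieudonné, *ÉGA IV₄*, Cor. 17.6.2 c′) (étale = flat + fibres sums of finite separable extensions),
  Thm. 18.5.17 (sections of étale schemes over henselian rings).
* [GortzWedhorn2020] U. Görtz, T. Wedhorn, *Algebraic Geometry I* (2nd ed.), §(4.8) and (14.20).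
* [StacksProject] The Stacks Project, Tags 081F, 0C0C (spreading out).
* [SerreTate1968] J.-P. Serre, J. Tate, *Good reduction of abelian varieties*, Ann. of Math. 88 (1968), §1.
-/

set_option autoImplicit false

noncomputable section

set_option backward.isDefEq.respectTransparency false

open CategoryTheory CategoryTheory.Limits AlgebraicGeometry IsDedekindDomain IsDedekindDomain.HeightOneSpectrum
open scoped NumberField nonZeroDivisors
open Literature.NumberTheory.EllipticCurves (genericFibre)
open Literature.NumberTheory.DiophantineGeometry (geomResidueField specialFibreFunctor)
open Literature.AlgebraicGeometry.RelativeSpec (ActionOver)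
open Literature.NumberTheory.GaloisRepresentations (IsAbsArithFrob)

namespace Literature.AlgebraicGeometry.Motives.IntegralModel

/-! ### All but finitely many `w`: the localised sheet model is étale and proper (★ SP-F spreading from the étale generic fibre) -/

section Cofinite

variable {F L : Type} [Field F] [NumberField F] [Field L] [NumberField L] [Algebra F L]
  {B : Type} [CommRing B] [Algebra (𝓞 L) B] [Algebra B L] [IsScalarTower (𝓞 L) B L]
  [Algebra (𝓞 F) B] [IsScalarTower (𝓞 F) B L] [IsScalarTower (𝓞 F) (𝓞 L) B]
  (hinj : Function.Injective (algebraMap B L))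

/-- `Spec L → Spec F` is ÉTALE for a finite extension of number fields (separable ⇒ formally étale, finite ⇒ finitely presented; Mathlib
`Algebra.FormallyEtale.of_isSeparable`). [cite: EGAIV4, Cor. 17.6.2 c′)] -/
theorem etale_specMap_numberField : Etale (Spec.map (CommRingCat.ofHom (algebraMap F L))) := by
  rw [HasRingHomProperty.Spec_iff (P := @Etale)]
  haveI : Algebra.FormallyEtale F L := Algebra.FormallyEtale.of_isSeparable F L
  haveI : Algebra.FinitePresentation F L := (Algebra.FinitePresentation.of_finiteType).mp inferInstance
  exact RingHom.etale_algebraMap.mpr ⟨inferInstance, inferInstance⟩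

/-- The generic fibre `Spec L ∕ F` of the sheet model is smooth of relative dimension `0`. [cite: EGAIV4, Cor. 17.6.2 c′)] -/
theorem smoothOfRelativeDimension_zero_sheetScheme_hom :
    SmoothOfRelativeDimension 0 (SchemeOver.restrictScalars F (Over.mk (𝟙 (Spec (.of L))))).hom := by
  haveI := etale_specMap_numberField (F := F) (L := L)
  change SmoothOfRelativeDimension 0 (𝟙 _ ≫ Spec.map (CommRingCat.ofHom (algebraMap F L)))
  infer_instance

/-- The generic fibre `Spec L ∕ F` of the sheet model is proper (finite). [cite: SerreTate1968, §1] -/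
theorem isProper_sheetScheme_hom : IsProper (SchemeOver.restrictScalars F (Over.mk (𝟙 (Spec (.of L))))).hom := by
  haveI : IsFinite (Spec.map (CommRingCat.ofHom (algebraMap F L))) := by
    rw [IsFinite.SpecMap_iff]
    exact RingHom.finite_algebraMap.mpr inferInstance
  change IsProper (𝟙 _ ≫ Spec.map (CommRingCat.ofHom (algebraMap F L)))
  infer_instance

/-- **For all but finitely many `w`, the localised sheet model `𝓑 ⊗ 𝒪_{F,(w)}` is étale (smooth of relative dimension `0`) and proper**, for
`B` finitely presented over `𝓞 L` (e.g. `𝓞 L`, `𝓞 L[1∕N]`): ★ SP-F `eventually_isSmoothProper_localise` at `n = 0` (spreading out from the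
étale proper generic fibre `Spec L → Spec F`).  The finitely many exceptions contain the primes ramified in `L`; no ramification theory is
used. [cite: StacksProject, Tags 081F, 0C0C] -/
theorem eventually_isSmoothProper_zero_sheetModelOf [Algebra.FinitePresentation (𝓞 L) B] :
    ∀ᶠ w : HeightOneSpectrum (𝓞 F) in Filter.cofinite, ((sheetModelOf (F := F) hinj).localise w).IsSmoothProper 0 := by
  haveI := locallyOfFinitePresentation_specMap_of_finitePresentation (F := F) (L := L) (B := B)
  haveI : LocallyOfFinitePresentation (sheetModelOf (F := F) hinj).total.hom := by
    change LocallyOfFinitePresentation (𝟙 (Spec (.of B)) ≫ Spec.map (CommRingCat.ofHom (algebraMap (𝓞 F) B)))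
    rw [Category.id_comp]; infer_instance
  haveI : QuasiCompact (sheetModelOf (F := F) hinj).total.hom := by
    change QuasiCompact (𝟙 (Spec (.of B)) ≫ Spec.map (CommRingCat.ofHom (algebraMap (𝓞 F) B)))
    rw [Category.id_comp]; infer_instance
  haveI : QuasiSeparated (sheetModelOf (F := F) hinj).total.hom := by
    change QuasiSeparated (𝟙 (Spec (.of B)) ≫ Spec.map (CommRingCat.ofHom (algebraMap (𝓞 F) B)))
    rw [Category.id_comp]; infer_instance
  exact eventually_isSmoothProper_localise (sheetModelOf (F := F) hinj) smoothOfRelativeDimension_zero_sheetScheme_hom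
    isProper_sheetScheme_hom

end Cofinite

/-! ## §4 The thickening currency of the moduli heart: `red_𝓨 (ℓ_e P) = θ(β,1)_s (red_𝓨 (ℓ_e Q)) → β = 1` -/

section Thickening

variable {F L : Type} [Field F] [NumberField F] [Field L] [NumberField L] [Algebra F L]
  {B : Type} [CommRing B] [Algebra (𝓞 L) B] [Algebra B L] [IsScalarTower (𝓞 L) B L]
  [Algebra (𝓞 F) B] [IsScalarTower (𝓞 F) B L]
  (hinj : Function.Injective (algebraMap B L)) (w : HeightOneSpectrum (𝓞 F)) (X : SchemeOver F)

omit [NumberField L] in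
/-- An embedding of fields absorbs only the identity: `e ∘ β⁻¹ = e → β = 1`. [folklore] -/
private theorem algEquiv_eq_one_of_comp_symm_eq (e : L →ₐ[F] AlgebraicClosure (w.adicCompletion F)) (β : L ≃ₐ[F] L)
    (h : e.comp (β.symm : L →ₐ[F] L) = e) : β = 1 := by
  ext x
  have hx := DFunLike.congr_fun h (β x)
  change e (β.symm (β x)) = e (β x) at hx
  rw [AlgEquiv.symm_apply_apply] at hx
  rw [AlgEquiv.one_apply]
  exact (e.toRingHom.injective hx).symm

/-- **DISJOINT SPECIAL SHEETS in the thickening currency (the hypothesis `hdisj` of FROB-SHEET ED. 3).**  Let `𝓜` be a model over the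
intermediate ring `B` of `X ⊗_F L`, so that `𝓨 := (restrictScalarsOfIntermediate hinj 𝓜).localise w` is a model over `𝒪_{F,(w)}` of the
thickening `R_L X` (on the nose), proper, and let `θ` be ANY action of `(L ≃ₐ[F] L) × G` on `𝓨` whose `Γ`-part has generic fibre the Galois
action of the thickening (MH's `_hθ`).  If the localised sheet model is étale-proper at `w` (★ `eventually_isSmoothProper_zero_sheetModelOf`:
all but finitely many `w`), then `red_𝓨 (ℓ_e P) = θ(β,1)_s (red_𝓨 (ℓ_e Q))` forces `β = 1` — the special images of distinct sheets are
disjoint. [cite: EGAIV4, Thm. 18.5.17] [cite: GortzWedhorn2020, (14.20)] -/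
theorem eq_one_of_geomReductionMap_thickeningLift_eq {G : Type*} [Group G]
    (𝓜 : IntegralModel B L ((baseChange F L).obj X))
    [IsProper ((restrictScalarsOfIntermediate (F := F) hinj 𝓜).localise w).total.hom]
    (h𝓑 : ((sheetModelOf (F := F) hinj).localise w).IsSmoothProper 0)
    (θ : ActionOver ((restrictScalarsOfIntermediate (F := F) hinj 𝓜).localise w).total.hom ((L ≃ₐ[F] L) × G))
    (hθ : ∀ γ : L ≃ₐ[F] L,
      (genericFibre (valuationSubringAtPrime F w) F).map (Over.isoMk (θ.aut (γ, 1)) (θ.aut_comp (γ, 1))).hom ≫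
          ((restrictScalarsOfIntermediate (F := F) hinj 𝓜).localise w).genericIso'.hom =
        ((restrictScalarsOfIntermediate (F := F) hinj 𝓜).localise w).genericIso'.hom ≫
          (Over.isoMk ((thickeningGalAction (L := L) X).aut γ) ((thickeningGalAction (L := L) X).aut_comp γ)).hom)
    (e : L →ₐ[F] AlgebraicClosure (w.adicCompletion F)) (β : L ≃ₐ[F] L)
    (P Q : AlgPoints X (AlgebraicClosure (w.adicCompletion F)))
    (h : ((restrictScalarsOfIntermediate (F := F) hinj 𝓜).localise w).geomReductionMap (thickeningLift e X P) =
      AlgPoints.map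
          ((specialFibreFunctor w).map (Over.isoMk (θ.aut (β, 1)) (θ.aut_comp (β, 1))).hom :
            ((restrictScalarsOfIntermediate (F := F) hinj 𝓜).localise w).reductionAt ⟶
              ((restrictScalarsOfIntermediate (F := F) hinj 𝓜).localise w).reductionAt)
        (((restrictScalarsOfIntermediate (F := F) hinj 𝓜).localise w).geomReductionMap (thickeningLift e X Q))) :
    β = 1 := by
  -- `θ(β,1)_s (red (ℓ_e Q)) = red (aut β · ℓ_e Q) = red (ℓ_{e ∘ β⁻¹} Q)`
  have h2 := geomReductionMap_map_thickeningGalAction_of_hθ X _ θ hθ β (thickeningLift e X Q)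
  rw [map_aut_thickeningLift] at h2
  -- equal reductions ⇒ equal sheets ⇒ `e = e ∘ β⁻¹`
  have hs := genericSheet_eq_of_geomReductionMap_eq hinj w 𝓜 h𝓑 _ _ (h.trans h2.symm)
  have he : e = e.comp (β.symm : L →ₐ[F] L) :=
    calc e = AlgPoints.embOfPoint ((baseChange F L).obj X) (thickeningLift e X P) := (embOfPoint_thickeningLift e X P).symm
      _ = AlgPoints.embOfPoint (Over.mk (𝟙 (Spec (.of L))))
            (genericSheet (thickeningLift e X P : AlgPoints (SchemeOver.restrictScalars F ((baseChange F L).obj X)) _)) :=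
          (embOfPoint_genericSheet _).symm
      _ = AlgPoints.embOfPoint (Over.mk (𝟙 (Spec (.of L))))
            (genericSheet (thickeningLift (e.comp (β.symm : L →ₐ[F] L)) X Q :
              AlgPoints (SchemeOver.restrictScalars F ((baseChange F L).obj X)) _)) := by rw [hs]
      _ = AlgPoints.embOfPoint ((baseChange F L).obj X) (thickeningLift (e.comp (β.symm : L →ₐ[F] L)) X Q) :=
          embOfPoint_genericSheet _
      _ = e.comp (β.symm : L →ₐ[F] L) := embOfPoint_thickeningLift _ X Q
  exact algEquiv_eq_one_of_comp_symm_eq w e β he.symm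

/-- **The sheet-wise Frobenius shadow EXISTS on every restricted model at every prime where the sheet model is étale-proper** — ★ A-p01 (g23)
`exists_sheetwise_frobeniusShadow` (heads (i) per-point `FrobeniusSheet`, (ii) the reading `Fr₀ (red (ℓ_{e′} P)) = red (ℓ_{e′} (σ • P))` on EVERY
sheet `e′`, (iii) `θ`-equivariance) with its hypothesis `hdisj` DISCHARGED by `eq_one_of_geomReductionMap_thickeningLift_eq`.  This is the form
`stub_HFROB` ∕ `stub_HEART` consume for MH's `𝓜 := restrictScalarsOfIntermediate hinj 𝓜ᵢ` (the RSZ model viewed over `𝓞 F`).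
[cite: SerreTate1968, §1 Lemma 2] [cite: GortzWedhorn2020, (14.20)] -/
theorem exists_sheetwise_frobeniusShadow_restrictScalarsOfIntermediate [Normal F L] {G : Type*} [Group G]
    (𝓜 : IntegralModel B L ((baseChange F L).obj X))
    [IsProper ((restrictScalarsOfIntermediate (F := F) hinj 𝓜).localise w).total.hom]
    [Flat ((restrictScalarsOfIntermediate (F := F) hinj 𝓜).localise w).total.hom]
    (h𝓑 : ((sheetModelOf (F := F) hinj).localise w).IsSmoothProper 0)
    (θ : ActionOver ((restrictScalarsOfIntermediate (F := F) hinj 𝓜).localise w).total.hom ((L ≃ₐ[F] L) × G))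
    (hθ : ∀ γ : L ≃ₐ[F] L,
      (genericFibre (valuationSubringAtPrime F w) F).map (Over.isoMk (θ.aut (γ, 1)) (θ.aut_comp (γ, 1))).hom ≫
          ((restrictScalarsOfIntermediate (F := F) hinj 𝓜).localise w).genericIso'.hom =
        ((restrictScalarsOfIntermediate (F := F) hinj 𝓜).localise w).genericIso'.hom ≫
          (Over.isoMk ((thickeningGalAction (L := L) X).aut γ) ((thickeningGalAction (L := L) X).aut_comp γ)).hom)
    {σ : Field.absoluteGaloisGroup (w.adicCompletion F)} (hσ : IsAbsArithFrob σ) (e : L →ₐ[F] AlgebraicClosure (w.adicCompletion F)) :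
    ∃ Fr₀ : AlgPoints ((restrictScalarsOfIntermediate (F := F) hinj 𝓜).localise w).reductionAt (geomResidueField w) →
        AlgPoints ((restrictScalarsOfIntermediate (F := F) hinj 𝓜).localise w).reductionAt (geomResidueField w),
      (∀ p, ∃ γ : L ≃ₐ[F] L,
        Fr₀ p = AlgPoints.map
            ((specialFibreFunctor w).map (Over.isoMk (θ.aut (γ, 1)) (θ.aut_comp (γ, 1))).hom :
              ((restrictScalarsOfIntermediate (F := F) hinj 𝓜).localise w).reductionAt ⟶
                ((restrictScalarsOfIntermediate (F := F) hinj 𝓜).localise w).reductionAt)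
          (AlgPoints.map (frobeniusOver _) p)) ∧
      (∀ (e' : L →ₐ[F] AlgebraicClosure (w.adicCompletion F)) (P : AlgPoints X (AlgebraicClosure (w.adicCompletion F))),
        Fr₀ (((restrictScalarsOfIntermediate (F := F) hinj 𝓜).localise w).geomReductionMap (thickeningLift e' X P)) =
          ((restrictScalarsOfIntermediate (F := F) hinj 𝓜).localise w).geomReductionMap (thickeningLift e' X (σ • P))) ∧
      (∀ (γ : L ≃ₐ[F] L) (p),
        Fr₀ (AlgPoints.map
            ((specialFibreFunctor w).map (Over.isoMk (θ.aut (γ, 1)) (θ.aut_comp (γ, 1))).hom :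
              ((restrictScalarsOfIntermediate (F := F) hinj 𝓜).localise w).reductionAt ⟶
                ((restrictScalarsOfIntermediate (F := F) hinj 𝓜).localise w).reductionAt) p) =
          AlgPoints.map
              ((specialFibreFunctor w).map (Over.isoMk (θ.aut (γ, 1)) (θ.aut_comp (γ, 1))).hom :
                ((restrictScalarsOfIntermediate (F := F) hinj 𝓜).localise w).reductionAt ⟶
                  ((restrictScalarsOfIntermediate (F := F) hinj 𝓜).localise w).reductionAt)
            (Fr₀ p)) :=
  exists_sheetwise_frobeniusShadow X _ θ hθ hσ e
    (fun β P Q h => eq_one_of_geomReductionMap_thickeningLift_eq hinj w X 𝓜 h𝓑 θ hθ e β P Q h)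

end Thickening

end Literature.AlgebraicGeometry.Motives.IntegralModel
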